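import Summits.AtomisticToContinuum.FouriersLaw.Theorems.VanishingNoiseTransferNoiseLocalityStubResponseDensityNoisyDyson1
import Summits.AtomisticToContinuum.FouriersLaw.Theorems.OddSectorIrreversibilityResponseDensityHarrisUniform

/-!
# Flip-noisy response density, step 2: weighted observables and uniform Harris bounds for the
embedded flip chain (helpers for stub `stub_responseDensityNoisy`)

Helper file `--supports stmt-AtomisticToContinuum-11975` (crux `NoiseLocality`, route
`VanishingNoiseTransfer`, line `relative-flip-energy-transfer`, stub 1b `stub_responseDensityNoisy`),
namespace `…NoiseLocality.StubResponseDensityNoisy.Dyson`.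

* `integrable_abs_integral_le_of_lintegral_le` — `|g| ≤ C W`, `∫⁻ W dμ ≤ A < ∞` give `g ∈ L¹(μ)`,
  `|∫ g dμ| ≤ C A`; `integral_resolventKernel_of_integrable` — `∫ g dR_r(z,·) = ∫ P_{t⁺} g (z) Exp_r(dt)`
  for `g ∈ L¹`; `integral_embeddedFlipKernel_eq` — `∫ g dK(z,·) = ∫ (Q g) dR_r(z,·)`;
* `lintegral_exp_embeddedFlipKernel_pow_le_unif` — `Kⁿ e^{ϑH} ≤ e^{ϑH} + C_p` for all `n`, uniformly
  for bath temperatures in `(0, 2T]` (iterated uniform drift of `…Dyson1`);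
* `harris_embeddedFlipKernel_unif` — for the pinned chain (all parameters `> 0`, `N ≥ 1`, `T > 0`,
  `0 < ϑ < 1/(2T)`, rate `r > 0`): constants `ᾱ ∈ (0,1)`, `C_π, C_g` such that for ALL bath
  temperatures in `[T/2, 2T]` the embedded flip chain `K = Q ∘ₖ R_r` has at most one invariant
  probability measure, every invariant probability measure `π` has `∫ e^{ϑH} dπ ≤ C_π`, and
  `|Kⁿφ(x) - π(φ)| ≤ C_g ᾱⁿ M e^{ϑH(x)}` for measurable `|φ| ≤ M e^{ϑH}` (the uniform Harris
  theorem `uniformHarris_pow` of the sibling route with the uniform drift and minorisation of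
  `…Dyson1`).

No definitions.
-/

noncomputable section

open MeasureTheory ProbabilityTheory Filter Topology Set
open scoped NNReal ENNReal

namespace Summit.AtomisticToContinuum.FouriersLaw.Theorems.NoiseLocality.StubResponseDensityNoisy.Dyson

open Literature.MathematicalPhysics.KineticTheory.HeatConduction
open Literature.Probability.Process Literature.MathematicalPhysics.KineticTheory OscillatorChain


/-! ### Weighted observables: integrability and affine bounds -/

section Weighted

variable {X : Type*} [MeasurableSpace X]

/-- If `∫⁻ W dμ ≤ A < ∞` (`W ≥ 0` measurable) and `|g| ≤ C W` (`g` a.e.-strongly measurable,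
`C ≥ 0`), then `g ∈ L¹(μ)` and `|∫ g dμ| ≤ C · A`. -/
theorem integrable_abs_integral_le_of_lintegral_le {μ : Measure X} {W : X → ℝ} (hWm : Measurable W)
    (hW0 : ∀ x, 0 ≤ W x) {A : ℝ≥0∞} (hA : A ≠ ⊤) (hμW : ∫⁻ x, ENNReal.ofReal (W x) ∂μ ≤ A)
    {g : X → ℝ} (hgm : AEStronglyMeasurable g μ) {C : ℝ} (hC : 0 ≤ C) (hg : ∀ x, |g x| ≤ C * W x) :
    Integrable g μ ∧ |∫ x, g x ∂μ| ≤ C * A.toReal := by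
  have hWi : Integrable W μ := ⟨hWm.aestronglyMeasurable,
    (hasFiniteIntegral_iff_ofReal (Eventually.of_forall hW0)).2 (hμW.trans_lt hA.lt_top)⟩
  have hgi : Integrable g μ := (hWi.const_mul C).mono' hgm
    (Eventually.of_forall fun x => by rw [Real.norm_eq_abs]; exact hg x)
  refine ⟨hgi, ?_⟩
  have hIW : ∫ x, W x ∂μ ≤ A.toReal := by
    rw [integral_eq_lintegral_of_nonneg_ae (Eventually.of_forall hW0) hWm.aestronglyMeasurable]
    exact ENNReal.toReal_mono hA hμW
  calc |∫ x, g x ∂μ| ≤ ∫ x, |g x| ∂μ := abs_integral_le_integral_abs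
    _ ≤ ∫ x, C * W x ∂μ := integral_mono hgi.abs (hWi.const_mul C) hg
    _ = C * ∫ x, W x ∂μ := integral_const_mul _ _
    _ ≤ C * A.toReal := mul_le_mul_of_nonneg_left hIW hC

end Weighted

section Kernels

variable {N : ℕ} {P : OscillatorChain} {T_L T_R : ℝ} (S : LangevinChainSemigroup P N T_L T_R)

/-- `∫ g dR_r(z, ·) = ∫ (P_{t⁺} g)(z) Exp_r(dt)` for every `g ∈ L¹(R_r(z, ·))` (strongly measurable). -/
theorem integral_resolventKernel_of_integrable {r : ℝ} (hr : 0 < r) (z : PhaseSpace N)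
    {g : PhaseSpace N → ℝ} (hgm : StronglyMeasurable g) (hg : Integrable g (S.resolventKernel r z)) :
    ∫ y, g y ∂(S.resolventKernel r z) = ∫ t, (∫ y, g y ∂(S.kernel t.toNNReal z)) ∂(expMeasure r) := by
  -- adapted from `integral_comp_const_prod_id` (Literature/…/LangevinChainResolvent.lean)
  haveI := isProbabilityMeasure_expMeasure hr
  rw [LangevinChainSemigroup.resolventKernel_eq] at hg ⊢
  rw [Kernel.integral_comp hg, Kernel.prod_apply, Kernel.const_apply, Kernel.id_apply,
    Measure.prod_dirac, integral_map (by fun_prop)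
      (hgm.integral_kernel (κ := S.timeKernel)).aestronglyMeasurable]
  rfl

/-- `∫ g dK(z, ·) = ∫ (Q g) dR_r(z, ·)` with `Q g = N⁻¹ ∑_i g ∘ momentumFlip i` (`N ≥ 1`), for
`Q g ∈ L¹(R_r(z, ·))`... more precisely for `g ∈ L¹(K(z, ·))`, strongly measurable. -/
theorem integral_embeddedFlipKernel_eq (hN : 0 < N) (r : ℝ) (z : PhaseSpace N)
    {g : PhaseSpace N → ℝ} (hg : Integrable g (S.embeddedFlipKernel r z)) :
    ∫ y, g y ∂(S.embeddedFlipKernel r z) =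
      ∫ y, (N : ℝ)⁻¹ * ∑ i : Fin N, g (momentumFlip i y) ∂(S.resolventKernel r z) := by
  rw [LangevinChainSemigroup.embeddedFlipKernel_eq] at hg ⊢
  rw [Kernel.integral_comp hg]
  exact integral_congr_ae (Eventually.of_forall fun y => integral_flipKernel hN g y)

end Kernels

/-- Window facts for baths at `T ± δ/2` with `|δ| < T`: both temperatures lie in `(T/2, 2T]`. -/
theorem bath_window {T δ : ℝ} (hT : 0 < T) (hδ : |δ| < T) :
    0 < T + δ / 2 ∧ T + δ / 2 ≤ 2 * T ∧ 0 < T - δ / 2 ∧ T - δ / 2 ≤ 2 * T ∧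
      T / 2 ≤ T + δ / 2 ∧ T / 2 ≤ T - δ / 2 := by
  have h := abs_lt.1 hδ
  refine ⟨by linarith, by linarith, by linarith, by linarith, by linarith, by linarith⟩

/-- `(c · ofReal e + B).toReal = c.toReal · e + B.toReal` for finite `c, B` and `e ≥ 0`. -/
theorem toReal_affine {c B : ℝ≥0∞} (hc : c ≠ ⊤) (hB : B ≠ ⊤) {e : ℝ} (he : 0 ≤ e) :
    (c * ENNReal.ofReal e + B).toReal = c.toReal * e + B.toReal := by
  rw [ENNReal.toReal_add (ENNReal.mul_ne_top hc ENNReal.ofReal_ne_top) hB, ENNReal.toReal_mul,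
    ENNReal.toReal_ofReal he]

section PowMoment

variable {N : ℕ} {ω₂ lam β γ : ℝ} (hω : 0 < ω₂) (hl : 0 < lam) (hβ : 0 < β) (hγ : 0 < γ) (hN : 0 < N)
  {T : ℝ} (hT : 0 < T) {ϑ : ℝ} (hϑ : 0 < ϑ) (hϑT : ϑ < 1 / (2 * T))
include hω hl hβ hγ hN hT hϑ hϑT

/-- **Uniform moment bound along the powers of the embedded flip chain**: for temperatures in
`(0, 2T]`, `(Kⁿ e^{ϑH})(x) ≤ e^{ϑH(x)} + C_p` for all `n`, with ONE `C_p < ∞` (iterated uniform drift). -/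
theorem lintegral_exp_embeddedFlipKernel_pow_le_unif {r : ℝ} (hr : 0 < r) :
    ∃ Cp : ℝ≥0∞, Cp ≠ ⊤ ∧
      ∀ (T_L T_R : ℝ) (hL : 0 < T_L) (_hL' : T_L ≤ 2 * T) (hR : 0 < T_R) (_hR' : T_R ≤ 2 * T)
        (n : ℕ) (x : PhaseSpace N),
        ∫⁻ y, ENNReal.ofReal (Real.exp (ϑ * (pinnedChain ω₂ lam β γ).hamiltonian N y))
            ∂((((pinnedChainSemigroup hω hl.le hβ.le hγ.le hN hL.le hR.le).embeddedFlipKernel r) ^ n) x) ≤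
          ENNReal.ofReal (Real.exp (ϑ * (pinnedChain ω₂ lam β γ).hamiltonian N x)) + Cp := by
  obtain ⟨a, b, ha, hb, hdrift⟩ := lintegral_exp_embeddedFlipKernel_le_unif hω hl hβ hγ hN hT hϑ hϑT hr
  set γ' : ℝ≥0 := a.toNNReal with hγ'def
  set K' : ℝ≥0 := b.toNNReal with hK'def
  have hγ'coe : (γ' : ℝ≥0∞) = a := ENNReal.coe_toNNReal ha.ne_top
  have hK'coe : (K' : ℝ≥0∞) = b := ENNReal.coe_toNNReal hb
  have hγ'1 : γ' < 1 := by rw [← ENNReal.coe_lt_coe, hγ'coe, ENNReal.coe_one]; exact ha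
  refine ⟨((K' / (1 - γ') : ℝ≥0) : ℝ≥0∞), ENNReal.coe_ne_top, fun T_L T_R hL hL' hR hR' n x => ?_⟩
  set V : PhaseSpace N → ℝ≥0 := fun z => (Real.exp (ϑ * (pinnedChain ω₂ lam β γ).hamiltonian N z)).toNNReal
  have hV : Measurable V := (continuous_real_toNNReal.comp (Real.continuous_exp.comp
    (continuous_const.mul (pinnedChain_continuous_hamiltonian ω₂ lam β γ N)))).measurable
  have hVcoe : ∀ z, (V z : ℝ≥0∞) =
      ENNReal.ofReal (Real.exp (ϑ * (pinnedChain ω₂ lam β γ).hamiltonian N z)) := fun z => rfl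
  set K := (pinnedChainSemigroup hω hl.le hβ.le hγ.le hN hL.le hR.le).embeddedFlipKernel r with hK
  haveI : IsMarkovKernel K :=
    (pinnedChainSemigroup hω hl.le hβ.le hγ.le hN hL.le hR.le).isMarkovKernel_embeddedFlipKernel hr
  have hdriftK : ∀ z, ∫⁻ y, (V y : ℝ≥0∞) ∂(K z) ≤ (γ' : ℝ≥0∞) * V z + K' := by
    intro z
    simp only [hVcoe]
    rw [hγ'coe, hK'coe]
    exact (hdrift T_L T_R hL hL' hR hR' z).2
  simp only [← hVcoe]
  refine (Harris.lintegral_pow_le_of_drift K hV hγ'1 hdriftK n x).trans ?_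
  gcongr
  calc (γ' : ℝ≥0∞) ^ n * V x ≤ 1 ^ n * V x := by gcongr; exact_mod_cast hγ'1.le
    _ = V x := by rw [one_pow, one_mul]

end PowMoment

/-! ### Uniform Harris bounds for the embedded flip chain of the pinned chain -/

section Harris

variable {N : ℕ} {ω₂ lam β γ : ℝ} (hω : 0 < ω₂) (hl : 0 < lam) (hβ : 0 < β) (hγ : 0 < γ) (hN : 0 < N)
  {T : ℝ} (hT : 0 < T) {ϑ : ℝ} (hϑ : 0 < ϑ) (hϑT : ϑ < 1 / (2 * T))
include hω hl hβ hγ hN hT hϑ hϑT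

/-- **Harris' theorem for the embedded flip chain, with constants uniform in the bath temperatures.**
For the pinned chain (all parameters `> 0`, `N ≥ 1`), `T > 0`, `0 < ϑ < 1/(2T)` and a rate `r > 0`
there are `ᾱ ∈ (0, 1)`, `C_π, C_g ≥ 0` such that for ALL bath temperatures `T_L, T_R ∈ [T/2, 2T]`
the embedded flip chain `K = Q ∘ₖ R_r` has at most one invariant probability measure, every
invariant probability measure `π` has `∫ e^{ϑH} dπ ≤ C_π`, and for every measurable `φ` with
`|φ| ≤ M e^{ϑH}` (`M ≥ 0`), all `n` and `x`: `|Kⁿφ(x) - π(φ)| ≤ C_g ᾱⁿ M e^{ϑH(x)}`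
(`uniformHarris_pow` with the uniform drift and minorisation of `…Dyson1`). -/
theorem harris_embeddedFlipKernel_unif {r : ℝ} (hr : 0 < r) :
    ∃ abar Cπ Cg : ℝ, 0 < abar ∧ abar < 1 ∧ 0 ≤ Cπ ∧ 0 ≤ Cg ∧
      ∀ (T_L T_R : ℝ) (hL : T / 2 ≤ T_L) (_hL' : T_L ≤ 2 * T) (hR : T / 2 ≤ T_R) (_hR' : T_R ≤ 2 * T),
        (∀ μ₁ μ₂ : Measure (PhaseSpace N), IsProbabilityMeasure μ₁ → IsProbabilityMeasure μ₂ →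
          Kernel.Invariant ((pinnedChainSemigroup hω hl.le hβ.le hγ.le hN ((half_pos hT).le.trans hL)
            ((half_pos hT).le.trans hR)).embeddedFlipKernel r) μ₁ →
          Kernel.Invariant ((pinnedChainSemigroup hω hl.le hβ.le hγ.le hN ((half_pos hT).le.trans hL)
            ((half_pos hT).le.trans hR)).embeddedFlipKernel r) μ₂ → μ₁ = μ₂) ∧
        ∀ π : Measure (PhaseSpace N), IsProbabilityMeasure π →
          Kernel.Invariant ((pinnedChainSemigroup hω hl.le hβ.le hγ.le hN ((half_pos hT).le.trans hL)
            ((half_pos hT).le.trans hR)).embeddedFlipKernel r) π →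
          (∫⁻ x, ENNReal.ofReal (Real.exp (ϑ * (pinnedChain ω₂ lam β γ).hamiltonian N x)) ∂π ≤
              ENNReal.ofReal Cπ) ∧
          ∀ (n : ℕ) (φ : PhaseSpace N → ℝ), Measurable φ → ∀ M : ℝ, 0 ≤ M →
            (∀ x, |φ x| ≤ M * Real.exp (ϑ * (pinnedChain ω₂ lam β γ).hamiltonian N x)) →
            ∀ x, |(∫ y, φ y ∂((((pinnedChainSemigroup hω hl.le hβ.le hγ.le hN
                ((half_pos hT).le.trans hL) ((half_pos hT).le.trans hR)).embeddedFlipKernel r) ^ n) x)) -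
                ∫ y, φ y ∂π| ≤
              Cg * abar ^ n * M * Real.exp (ϑ * (pinnedChain ω₂ lam β γ).hamiltonian N x) := by
  set P := pinnedChain ω₂ lam β γ with hP
  set Hm := P.hamiltonian N with hHm
  -- the Lyapunov function `V = e^{ϑH}` as an `ℝ≥0`-valued function
  set V : PhaseSpace N → ℝ≥0 := fun z => (Real.exp (ϑ * Hm z)).toNNReal with hVdef
  have hV : Measurable V := (continuous_real_toNNReal.comp (Real.continuous_exp.comp
    (continuous_const.mul (pinnedChain_continuous_hamiltonian ω₂ lam β γ N)))).measurable
  have hVcoe : ∀ z, (V z : ℝ≥0∞) = ENNReal.ofReal (Real.exp (ϑ * Hm z)) := fun z => rfl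
  have hVreal : ∀ z, (V z : ℝ) = Real.exp (ϑ * Hm z) := fun z =>
    Real.coe_toNNReal _ (Real.exp_pos _).le
  have hV1 : ∀ z, (1 : ℝ) ≤ V z := fun z => by
    rw [hVreal]; exact Real.one_le_exp (mul_nonneg hϑ.le (pinnedChain_hamiltonian_nonneg hω.le hl.le hβ.le γ N z))
  -- the uniform drift
  obtain ⟨a, b, ha, hb, hdrift⟩ := lintegral_exp_embeddedFlipKernel_le_unif hω hl hβ hγ hN hT hϑ hϑT hr
  set γ' : ℝ≥0 := a.toNNReal with hγ'def
  set K' : ℝ≥0 := b.toNNReal with hK'def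
  have hγ'coe : (γ' : ℝ≥0∞) = a := ENNReal.coe_toNNReal ha.ne_top
  have hK'coe : (K' : ℝ≥0∞) = b := ENNReal.coe_toNNReal hb
  have hγ'1 : γ' < 1 := by rw [← ENNReal.coe_lt_coe, hγ'coe, ENNReal.coe_one]; exact ha
  -- the small set `{V ≤ R₀}` = `{H ≤ E}`
  have h1γ : 0 < 1 - γ' := tsub_pos_of_lt hγ'1
  set R₀ : ℝ≥0 := (2 * K' + 1) / (1 - γ') with hR₀def
  have hR₀γ : (1 - γ') * R₀ = 2 * K' + 1 := by rw [hR₀def, mul_comm, div_mul_cancel₀ _ h1γ.ne']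
  have hRcond : 2 * K' < (1 - γ') * R₀ := by rw [hR₀γ]; exact lt_add_one _
  have hR₀1 : (1 : ℝ≥0) ≤ R₀ := by
    rw [hR₀def, le_div_iff₀ h1γ, one_mul]
    exact tsub_le_self.trans le_add_self
  have hR₀1' : (1 : ℝ) ≤ R₀ := by exact_mod_cast hR₀1
  set E : ℝ := Real.log R₀ / ϑ with hE
  have hVE : ∀ x : PhaseSpace N, V x ≤ R₀ → Hm x ≤ E := by
    intro x hx
    have hx' : Real.exp (ϑ * Hm x) ≤ R₀ := by rw [← hVreal]; exact_mod_cast hx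
    rw [hE, le_div_iff₀ hϑ, mul_comm, Real.le_log_iff_exp_le (by linarith)]
    exact hx'
  -- the uniform minorisation on `{H ≤ E}`
  obtain ⟨α, hα0, hαtop, hminor⟩ := embeddedFlipKernel_minorization_unif hω hl hβ hγ hN hT hr E
  set αn : ℝ≥0 := α.toNNReal with hαndef
  have hαcoe : (αn : ℝ≥0∞) = α := ENNReal.coe_toNNReal hαtop.ne
  have hαn : 0 < αn := by rw [← ENNReal.coe_pos, hαcoe]; exact hα0
  -- the uniform Harris theorem
  obtain ⟨abar, βh, h0, h1, hβh, hfam⟩ := uniformHarris_pow hV hγ'1 hαn hRcond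
  set Cπ : ℝ := ((K' / (1 - γ') : ℝ≥0) : ℝ) with hCπ
  have hCπ0 : 0 ≤ Cπ := NNReal.coe_nonneg _
  refine ⟨abar, Cπ, 2 / βh + 1 + Cπ, h0, h1, hCπ0, by positivity, fun T_L T_R hL hL' hR hR' => ?_⟩
  have hL0 : 0 < T_L := (half_pos hT).trans_le hL
  have hR0 : 0 < T_R := (half_pos hT).trans_le hR
  set Sg := pinnedChainSemigroup hω hl.le hβ.le hγ.le hN ((half_pos hT).le.trans hL)
    ((half_pos hT).le.trans hR) with hSg
  set K := Sg.embeddedFlipKernel r with hKdef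
  haveI : IsMarkovKernel K := Sg.isMarkovKernel_embeddedFlipKernel hr
  -- drift and minorisation of this `K` in Harris' format
  have hdriftK : ∀ x, ∫⁻ y, (V y : ℝ≥0∞) ∂(K x) ≤ (γ' : ℝ≥0∞) * V x + K' := by
    intro x
    simp only [hVcoe]
    rw [hγ'coe, hK'coe]
    exact (hdrift T_L T_R hL0 hL' hR0 hR' x).2
  obtain ⟨ν, hν, hνmin⟩ := hminor T_L T_R hL hL' hR hR'
  haveI := hν
  have hminorK : ∀ x, V x ≤ R₀ → αn • ν ≤ K x := by
    intro x hx
    have h := hνmin x (hVE x hx)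
    refine Measure.le_iff.2 fun s hs => ?_
    have h' := Measure.le_iff.1 h s hs
    rw [Measure.smul_apply, smul_eq_mul, ← hαcoe] at h'
    rw [Measure.smul_apply, ENNReal.smul_def, smul_eq_mul]
    exact h'
  obtain ⟨huniq, hmom⟩ := hfam K hdriftK ν hminorK
  refine ⟨huniq, fun π hπ hinv => ?_⟩
  haveI := hπ
  obtain ⟨hπV, hgeo⟩ := hmom π hπ hinv
  have hπV' : ∫⁻ x, ENNReal.ofReal (Real.exp (ϑ * Hm x)) ∂π ≤ ENNReal.ofReal Cπ := by
    simp only [← hVcoe]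
    refine hπV.trans (le_of_eq ?_)
    rw [hCπ, ENNReal.ofReal_coe_nnreal]
  refine ⟨hπV', fun n φ hφm M hM hφ x => ?_⟩
  have hmπ : (∫⁻ z, (V z : ℝ≥0∞) ∂π).toReal ≤ Cπ := by
    rw [hCπ]; exact ENNReal.toReal_le_coe_of_le_coe hπV
  rcases hM.eq_or_lt with hM0 | hMpos
  · -- `M = 0`: `φ ≡ 0`
    have hφ0 : φ = fun _ => 0 := funext fun y => by
      have := hφ y; rw [← hM0, zero_mul] at this; exact abs_nonpos_iff.1 this
    rw [hφ0, integral_zero, integral_zero, sub_zero, abs_zero, ← hM0, mul_zero, zero_mul]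
  · -- `M > 0`: rescale to `|φ'| ≤ β V ≤ 1 + β V`
    set φ' : PhaseSpace N → ℝ := fun y => βh / M * φ y with hφ'
    have hφ'm : Measurable φ' := hφm.const_mul _
    have hφ'b : ∀ y, |φ' y| ≤ 1 + βh * V y := fun y => by
      rw [hφ', abs_mul, abs_of_pos (div_pos hβh hMpos), hVreal]
      have h1 : βh / M * |φ y| ≤ βh / M * (M * Real.exp (ϑ * Hm y)) :=
        mul_le_mul_of_nonneg_left (hφ y) (div_pos hβh hMpos).le
      have h2 : βh / M * (M * Real.exp (ϑ * Hm y)) = βh * Real.exp (ϑ * Hm y) := by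
        field_simp
      linarith [h1, h2]
    have h := hgeo n φ' hφ'm hφ'b x
    rw [hφ', integral_const_mul, integral_const_mul, ← mul_sub, abs_mul,
      abs_of_pos (div_pos hβh hMpos)] at h
    -- divide by `βh/M`
    have hcpos : 0 < M / βh := div_pos hMpos hβh
    have h2 := mul_le_mul_of_nonneg_left h hcpos.le
    rw [← mul_assoc, show M / βh * (βh / M) = 1 by field_simp, one_mul] at h2
    refine h2.trans ?_
    rw [hVreal] at *
    have hVx : 1 ≤ Real.exp (ϑ * Hm x) := by have := hV1 x; rwa [hVreal] at this
    have hβ0 : 0 < βh := hβh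
    have key : M / βh * (abar ^ n * (2 + βh * Real.exp (ϑ * Hm x) + βh * (∫⁻ z, (V z : ℝ≥0∞) ∂π).toReal)) =
        abar ^ n * M * (2 / βh + Real.exp (ϑ * Hm x) + (∫⁻ z, (V z : ℝ≥0∞) ∂π).toReal) := by
      field_simp
    rw [key]
    have hpow : 0 ≤ abar ^ n * M := mul_nonneg (pow_nonneg h0.le n) hM
    calc abar ^ n * M * (2 / βh + Real.exp (ϑ * Hm x) + (∫⁻ z, (V z : ℝ≥0∞) ∂π).toReal)
        ≤ abar ^ n * M * (2 / βh + Real.exp (ϑ * Hm x) + Cπ) := by gcongr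
      _ ≤ abar ^ n * M * ((2 / βh + 1 + Cπ) * Real.exp (ϑ * Hm x)) := by
          refine mul_le_mul_of_nonneg_left ?_ hpow
          have h2β : 0 ≤ 2 / βh := by positivity
          nlinarith
      _ = (2 / βh + 1 + Cπ) * abar ^ n * M * Real.exp (ϑ * Hm x) := by ring

end Harris

/-- Registered helper sub-goal `helper_responseDensityNoisyDysonHarris` of stmt-AtomisticToContinuum-11975
(= `harris_embeddedFlipKernel_unif`, fully quantified, notation-free one-line form). -/
theorem helper_responseDensityNoisyDysonHarris : ∀ (ω₂ lam β γ : ℝ) (hω : 0 < ω₂) (hl : 0 < lam) (hβ : 0 < β) (hγ : 0 < γ) (N : ℕ) (hN : 0 < N) (T : ℝ) (hT : 0 < T) (ϑ : ℝ), 0 < ϑ → ϑ < 1 / (2 * T) → ∀ (r : ℝ), 0 < r → ∃ abar Cπ Cg : ℝ, 0 < abar ∧ abar < 1 ∧ 0 ≤ Cπ ∧ 0 ≤ Cg ∧ ∀ (T_L T_R : ℝ) (hL : T / 2 ≤ T_L) (_hL' : T_L ≤ 2 * T) (hR : T / 2 ≤ T_R) (_hR' : T_R ≤ 2 * T), (∀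 μ₁ μ₂ : MeasureTheory.Measure (Literature.MathematicalPhysics.KineticTheory.HeatConduction.PhaseSpace N), MeasureTheory.IsProbabilityMeasure μ₁ → MeasureTheory.IsProbabilityMeasure μ₂ → ProbabilityTheory.Kernel.Invariant ((Literature.MathematicalPhysics.KineticTheory.HeatConduction.pinnedChainSemigroup hω hl.le hβ.le hγ.le hN ((half_pos hT).le.trans hL) ((half_pos hT).le.trans hR)).embeddedFlipKernel r) μ₁ → ProbabilityTheory.Kernel.Invariant ((Literature.MathematicalPhysics.KineticTheory.HeatConduction.pinnedChainSemigroup hω hl.le hβ.le hγ.le hN ((half_pos hT).le.trans hL) ((half_pos hT).le.trans hR)).embeddedFlipKernel r) μ₂ → μ₁ = μ₂) ∧ ∀ π : MeasureTheory.Measure (Literature.MathematicalPhysics.KineticTheory.HeatConduction.PhaseSpace N), MeasureTheory.IsProbabilityMeasure π → ProbabilityTheory.Kernel.Invariant ((Literature.MathematicalPhysics.KineticTheory.HeatConduction.pinnedChainSemigroup hω hl.le hβ.le hγ.le hN ((half_pos hT).le.trans hL) ((half_pos hT).le.trans hR)).embeddedFlipKernel r) π → (∫⁻ x, ENNReal.ofReal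 (Real.exp (ϑ * (Literature.MathematicalPhysics.KineticTheory.HeatConduction.pinnedChain ω₂ lam β γ).hamiltonian N x)) ∂π ≤ ENNReal.ofReal Cπ) ∧ ∀ (n : ℕ) (φ : Literature.MathematicalPhysics.KineticTheory.HeatConduction.PhaseSpace N → ℝ), Measurable φ → ∀ M : ℝ, 0 ≤ M → (∀ x, |φ x| ≤ M * Real.exp (ϑ * (Literature.MathematicalPhysics.KineticTheory.HeatConduction.pinnedChain ω₂ lam β γ).hamiltonian N x)) → ∀ x, |(∫ y, φ y ∂((((Literature.MathematicalPhysics.KineticTheory.HeatConduction.pinnedChainSemigroup hω hl.le hβ.le hγ.le hN ((half_pos hT).le.trans hL) ((half_pos hT).le.trans hR)).embeddedFlipKernel r) ^ n) x)) - ∫ y, φ y ∂π| ≤ Cg * abar ^ n * M * Real.exp (ϑ * (Literature.MathematicalPhysics.KineticTheory.HeatConduction.pinnedChain ω₂ lam β γ).hamiltonian N x) :=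
  fun _ _ _ _ hω hl hβ hγ _ hN _ hT _ hϑ hϑT _ hr => harris_embeddedFlipKernel_unif hω hl hβ hγ hN hT hϑ hϑT hr

end Summit.AtomisticToContinuum.FouriersLaw.Theorems.NoiseLocality.StubResponseDensityNoisy.Dyson

end
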